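import Mathlib
import Literature.AlgebraicGeometry.Motives.ChernClassesProofs
import Summits.ResolutionOfSingularities.ResolutionOfSingularities.Theorems.HomologicalConductorNoZenoFullSheafEndEquiv
import HarnessLib

/-!
# Crux `NoZenoR` (stmt-ResolutionOfSingularities-19943), line `sandwich-cluster`, G-layer:
# `Hom_T(M, M′) ≃ Hom(M~, M′~)` for full sheaves (the Hom-version of G2 (v); assembly items A4/A5, step H1)

OURS (cell res-hironaka, chain W4.4; KERNEL-L0 §16 R6 row G2, holder res-D-pv-045 AS res-L0-w44-stub-8;
plan `D/res-D-pv-045/SketchG2Assembly.lean` A4/A5). Generalises `…FullSheafEndLift` (`End`) to two modules: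
`T` a domain with `K(X) = Frac T` (instance arguments), `φ : M →ₗ[T] V`, `φ′ : M′ →ₗ[T] V′` injective
embeddings into `K(X)`-vector spaces with `K(X) · φ(M) = V`, and full sheaves `M~ = 𝒪_X · φ(M)`,
`M′~ = 𝒪_X · φ′(M′)`. Used for the presentation `T^n ↠ M` (A5: a sheaf endomorphism of `M~` factors through
`(T^n)~ ⟶ M~` iff the module endomorphism factors through `T^n ↠ M`). Nothing of [claim: Hironaka2017] is used.

* **`homLift φ φ′ … u : V →ₗ[K(X)] V′`** — the `K(X)`-linear extension of `u : M →ₗ[T] M′` (`ū ∘ φ = φ′ ∘ u`;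
  uniqueness, `homLift_id`, `homLift_comp`, `homLift_add`);
* **`sheafHomOf φ φ′ … u : M~ ⟶ M′~`** (`mapOfLinear ∘ homLift`; values on `σ_{φ m}`; `comp`/`add`);
* GIVEN (ii) for `M′` (`hH0′ : values of global sections of M′~ = φ′(M′)`): **`homOfSheafHom … f : M →ₗ[T] M′`**
  and **`sheafHomEquiv : (M →ₗ[T] M′) ≃+ (M~ ⟶ M′~)`** (`T` acting on global sections through a ring map
  `ρ : T → Γ(X, 𝒪_X)` over `K(X)`, hypothesis `hρ`).

Everything is proved; no named facts. [this work]
-/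

-- single-problem summit: the doubled namespace component `ResolutionOfSingularities` is forced
set_option linter.dupNamespace false

noncomputable section

universe u v w w'

open CategoryTheory AlgebraicGeometry TopologicalSpace Opposite
open Literature.AlgebraicGeometry.Motives

namespace Summit.ResolutionOfSingularities.ResolutionOfSingularities.Theorems.NoZeno.SandwichCluster.FullSheaf

section LinearAlgebra

variable {T : Type u} [CommRing T] [IsDomain T] {K : Type v} [Field K] [Algebra T K] [IsFractionRing T K]
variable {V : Type w} [AddCommGroup V] [Module K V] [Module T V] [IsScalarTower T K V]
variable {V' : Type w'} [AddCommGroup V'] [Module K V'] [Module T V'] [IsScalarTower T K V']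
variable {M : Type*} [AddCommGroup M] [Module T M] {M' : Type*} [AddCommGroup M'] [Module T M']
variable (φ : M →ₗ[T] V) (φ' : M' →ₗ[T] V')
variable (hφinj : Function.Injective φ) (hspan : Submodule.span K (Set.range φ) = ⊤)
include hφinj hspan

omit [IsScalarTower T K V] [IsFractionRing T K] hφinj hspan in
/-- Non-zero-divisors of `T` act invertibly on a `K`-vector space (`K = Frac T`); `K` is recorded through
the hypothesis `hK` to fix the field. [folklore] -/
theorem isUnit_algebraMap_moduleEnd (hK : Function.Injective (algebraMap T K)) (s : nonZeroDivisors T) :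
    IsUnit (algebraMap T (Module.End T V') (s : T)) := by
  have hs : (algebraMap T K (s : T)) ≠ 0 := (map_ne_zero_iff _ hK).mpr (nonZeroDivisors.ne_zero s.2)
  have hsmul : ∀ v : V', (s : T) • v = algebraMap T K (s : T) • v := fun v => (algebraMap_smul K (s : T) v).symm
  refine (Module.End.isUnit_iff _).mpr ⟨fun v w hvw => ?_, fun v => ⟨(algebraMap T K s)⁻¹ • v, ?_⟩⟩
  · have h' : algebraMap T K (s : T) • v = algebraMap T K (s : T) • w := by
      rw [← hsmul, ← hsmul]; exact hvw
    exact smul_right_injective V' hs h'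
  · change (s : T) • ((algebraMap T K (s : T))⁻¹ • v) = v
    rw [hsmul, ← mul_smul, mul_inv_cancel₀ hs, one_smul]

/-- **`homLift u : V →ₗ[K] V′`, the `K`-linear extension of `u : M →ₗ[T] M′` along `φ`, `φ′`.** [folklore] -/
def homLift (u : M →ₗ[T] M') : V →ₗ[K] V' :=
  haveI := isLocalizedModule_of_span_eq_top φ hφinj hspan
  (IsLocalizedModule.lift (nonZeroDivisors T) φ (φ' ∘ₗ u)
    (fun s => isUnit_algebraMap_moduleEnd (IsFractionRing.injective T K) s)).extendScalarsOfIsLocalization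
    (nonZeroDivisors T) K

/-- `ū (φ m) = φ′ (u m)`. [folklore] -/
@[simp]
theorem homLift_apply_map (u : M →ₗ[T] M') (m : M) : homLift φ φ' hφinj hspan u (φ m) = φ' (u m) := by
  haveI := isLocalizedModule_of_span_eq_top φ hφinj hspan
  exact IsLocalizedModule.lift_apply (nonZeroDivisors T) φ (φ' ∘ₗ u)
    (fun s => isUnit_algebraMap_moduleEnd (IsFractionRing.injective T K) s) m

/-- `ū` maps `φ(M)` into `φ′(M′)`. [folklore] -/
theorem homLift_mapsTo (u : M →ₗ[T] M') :
    Set.MapsTo (homLift φ φ' hφinj hspan u) (Set.range φ) (Set.range φ') := by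
  rintro _ ⟨m, rfl⟩
  exact ⟨u m, (homLift_apply_map φ φ' hφinj hspan u m).symm⟩

/-- Uniqueness of the extension. [folklore] -/
theorem homLift_unique (u : M →ₗ[T] M') (ψ : V →ₗ[K] V') (hψ : ∀ m : M, ψ (φ m) = φ' (u m)) :
    ψ = homLift φ φ' hφinj hspan u := by
  refine LinearMap.ext_on_range hspan fun m => ?_
  rw [hψ, homLift_apply_map]

/-- Additivity. [folklore] -/
theorem homLift_add (u u' : M →ₗ[T] M') :
    homLift φ φ' hφinj hspan (u + u') = homLift φ φ' hφinj hspan u + homLift φ φ' hφinj hspan u' :=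
  (homLift_unique φ φ' hφinj hspan (u + u') _ fun m => by
    rw [LinearMap.add_apply, homLift_apply_map, homLift_apply_map, LinearMap.add_apply, map_add]).symm

/-- `T`-scalars. [folklore] -/
theorem homLift_smul (a : T) (u : M →ₗ[T] M') :
    homLift φ φ' hφinj hspan (a • u) = algebraMap T K a • homLift φ φ' hφinj hspan u :=
  (homLift_unique φ φ' hφinj hspan (a • u) _ fun m => by
    rw [LinearMap.smul_apply, homLift_apply_map, LinearMap.smul_apply, LinearMap.map_smul,
      algebraMap_smul]).symm

end LinearAlgebra

/-! ## The induced morphisms of full sheaves and the Hom-equivalence -/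

section Sheaf

variable {X : Scheme.{u}} [IsIntegral X]
variable {T : Type*} [CommRing T] [IsDomain T] [Algebra T X.functionField] [IsFractionRing T X.functionField]
variable {V : Type u} [AddCommGroup V] [Module X.functionField V] [Module T V] [IsScalarTower T X.functionField V]
variable {V' : Type u} [AddCommGroup V'] [Module X.functionField V'] [Module T V']
  [IsScalarTower T X.functionField V']
variable {M : Type*} [AddCommGroup M] [Module T M] {M' : Type*} [AddCommGroup M'] [Module T M']
variable (φ : M →ₗ[T] V) (φ' : M' →ₗ[T] V')
variable (hφinj : Function.Injective φ) (hspan : Submodule.span X.functionField (Set.range φ) = ⊤)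

attribute [local instance] stalkModule stalk_isScalarTower fnModule nonempty_top

include hφinj hspan in
/-- **`sheafHomOf u : M~ ⟶ M′~`**, the morphism of full sheaves induced by `u : M →ₗ[T] M′`. [this work] -/
def sheafHomOf (u : M →ₗ[T] M') :
    generatedSheaf (X := X) V (Set.range φ) ⟶ generatedSheaf V' (Set.range φ') :=
  mapOfLinear (homLift φ φ' hφinj hspan u) (homLift_mapsTo φ φ' hφinj hspan u)

include hφinj hspan in
/-- Values of `sheafHomOf u`. [folklore] -/
@[simp]
theorem fn_sheafHomOf_app (u : M →ₗ[T] M') (U : X.Opens) (s : Γ(generatedSheaf V (Set.range φ), U))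
    (y : U) : fn V' (Set.range φ') ((sheafHomOf φ φ' hφinj hspan u).app U s) y =
      homLift φ φ' hφinj hspan u (fn V (Set.range φ) s y) := rfl

include hφinj hspan in
/-- `sheafHomOf u` takes `σ_{φ m}` to `σ_{φ′ (u m)}`. [this work] -/
theorem sheafHomOf_app_ofMem (u : M →ₗ[T] M') (U : X.Opens) (m : M) :
    (sheafHomOf φ φ' hφinj hspan u).app U (ofMem V (Set.range φ) U (φ m) ⟨m, rfl⟩) =
      ofMem V' (Set.range φ') U (φ' (u m)) ⟨u m, rfl⟩ :=
  section_ext V' (Set.range φ') (funext fun y => by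
    rw [fn_sheafHomOf_app, fn_ofMem, fn_ofMem, homLift_apply_map])

include hφinj hspan in
/-- Additivity of `sheafHomOf`. [folklore] -/
theorem sheafHomOf_add (u u' : M →ₗ[T] M') :
    sheafHomOf (X := X) φ φ' hφinj hspan (u + u') =
      sheafHomOf φ φ' hφinj hspan u + sheafHomOf φ φ' hφinj hspan u' := by
  refine Scheme.Modules.hom_ext _ _ fun U => ?_
  ext s
  exact section_ext V' (Set.range φ') (funext fun y => by rw [fn_sheafHomOf_app, homLift_add]; rfl)

/-- The action of `f : M~ ⟶ M′~` on values of global sections. [folklore] -/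
def homValue (f : generatedSheaf (X := X) V (Set.range φ) ⟶ generatedSheaf V' (Set.range φ')) : M →+ V' :=
  (globalValue V' (Set.range φ')).comp ((f.app ⊤).hom.comp (secOf φ))

omit [IsDomain T] [Algebra T X.functionField] [IsFractionRing T X.functionField]
  [IsScalarTower T X.functionField V] [IsScalarTower T X.functionField V'] in
/-- Unfolding. [folklore] -/
theorem homValue_apply (f : generatedSheaf (X := X) V (Set.range φ) ⟶ generatedSheaf V' (Set.range φ')) (m : M) :
    homValue φ φ' f m = globalValue V' (Set.range φ') (f.app ⊤ (secOf φ m)) := rfl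

omit [IsDomain T] [IsFractionRing T X.functionField] [IsScalarTower T X.functionField V'] in
/-- `homValue` is `T`-semilinear. [folklore] -/
theorem homValue_smul (ρ : T →+* Γ(X, ⊤))
    (hρ : ∀ a : T, X.germToFunctionField ⊤ (ρ a) = algebraMap T X.functionField a)
    (f : generatedSheaf (X := X) V (Set.range φ) ⟶ generatedSheaf V' (Set.range φ')) (a : T) (m : M) :
    homValue φ φ' f (a • m) = algebraMap T X.functionField a • homValue φ φ' f m := by
  rw [homValue_apply, homValue_apply, secOf_smul φ ρ hρ]
  change globalValue V' (Set.range φ') (f.app ⊤ (ρ a • secOf φ m)) = _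
  rw [Scheme.Modules.Hom.app_smul, globalValue_apply, globalValue_apply, fn_smul,
    evalFn_eq_germToFunctionField, hρ]

omit [IsDomain T] [Algebra T X.functionField] [IsFractionRing T X.functionField]
  [IsScalarTower T X.functionField V] [IsScalarTower T X.functionField V'] in
/-- Under (ii) for `M′`, `homValue` lands in `φ′(M′)`. [folklore] -/
theorem homValue_mem
    (hH0' : ∀ v : V', (∀ x : X, v ∈ stalkSpan (X := X) V' (Set.range φ') x) ↔ v ∈ Set.range φ')
    (f : generatedSheaf (X := X) V (Set.range φ) ⟶ generatedSheaf V' (Set.range φ')) (m : M) :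
    homValue φ φ' f m ∈ LinearMap.range φ' := by
  rw [LinearMap.mem_range]
  obtain ⟨m', hm'⟩ := globalValue_mem V' (Set.range φ') hH0' (f.app ⊤ (secOf φ m))
  exact ⟨m', hm'⟩

omit [IsDomain T] [IsFractionRing T X.functionField] in
/-- **`homOfSheafHom f : M →ₗ[T] M′`**, the action of `f : M~ ⟶ M′~` on `M → Γ(X, M~) → Γ(X, M′~) = φ′(M′) ≅ M′`
(GIVEN (ii) for `M′`). [this work] -/
def homOfSheafHom (hφ'inj : Function.Injective φ') (ρ : T →+* Γ(X, ⊤))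
    (hρ : ∀ a : T, X.germToFunctionField ⊤ (ρ a) = algebraMap T X.functionField a)
    (hH0' : ∀ v : V', (∀ x : X, v ∈ stalkSpan (X := X) V' (Set.range φ') x) ↔ v ∈ Set.range φ')
    (f : generatedSheaf (X := X) V (Set.range φ) ⟶ generatedSheaf V' (Set.range φ')) : M →ₗ[T] M' where
  toFun m := (LinearEquiv.ofInjective φ' hφ'inj).symm ⟨homValue φ φ' f m, homValue_mem φ φ' hH0' f m⟩
  map_add' m m' := by
    rw [← map_add]
    congr 1
    exact Subtype.ext (map_add (homValue φ φ' f) m m')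
  map_smul' a m := by
    rw [RingHom.id_apply, ← map_smul (LinearEquiv.ofInjective φ' hφ'inj).symm a]
    congr 1
    apply Subtype.ext
    change homValue φ φ' f (a • m) = a • homValue φ φ' f m
    rw [homValue_smul φ φ' ρ hρ, algebraMap_smul]

omit [IsDomain T] [IsFractionRing T X.functionField] in
/-- Defining property: `φ′ (homOfSheafHom f m) =` value of `f(σ_{φ m})`. [folklore] -/
theorem map_homOfSheafHom (hφ'inj : Function.Injective φ') (ρ : T →+* Γ(X, ⊤))
    (hρ : ∀ a : T, X.germToFunctionField ⊤ (ρ a) = algebraMap T X.functionField a)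
    (hH0' : ∀ v : V', (∀ x : X, v ∈ stalkSpan (X := X) V' (Set.range φ') x) ↔ v ∈ Set.range φ')
    (f : generatedSheaf (X := X) V (Set.range φ) ⟶ generatedSheaf V' (Set.range φ')) (m : M) :
    φ' (homOfSheafHom φ φ' hφ'inj ρ hρ hH0' f m) = globalValue V' (Set.range φ') (f.app ⊤ (secOf φ m)) := by
  change φ' ((LinearEquiv.ofInjective φ' hφ'inj).symm ⟨homValue φ φ' f m, homValue_mem φ φ' hH0' f m⟩) = _
  have h := LinearEquiv.apply_symm_apply (LinearEquiv.ofInjective φ' hφ'inj)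
    ⟨homValue φ φ' f m, homValue_mem φ φ' hH0' f m⟩
  have h' := congrArg Subtype.val h
  rw [LinearEquiv.ofInjective_apply] at h'
  exact h'.trans (homValue_apply φ φ' f m)

include hφinj hspan in
/-- `u ↦ sheafHomOf u ↦ u`. [this work] -/
theorem homOfSheafHom_sheafHomOf (hφ'inj : Function.Injective φ') (ρ : T →+* Γ(X, ⊤))
    (hρ : ∀ a : T, X.germToFunctionField ⊤ (ρ a) = algebraMap T X.functionField a)
    (hH0' : ∀ v : V', (∀ x : X, v ∈ stalkSpan (X := X) V' (Set.range φ') x) ↔ v ∈ Set.range φ')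
    (u : M →ₗ[T] M') : homOfSheafHom φ φ' hφ'inj ρ hρ hH0' (sheafHomOf φ φ' hφinj hspan u) = u := by
  refine LinearMap.ext fun m => hφ'inj ?_
  rw [map_homOfSheafHom]
  change globalValue V' (Set.range φ') ((sheafHomOf φ φ' hφinj hspan u).app ⊤
    (ofMem V (Set.range φ) ⊤ (φ m) ⟨m, rfl⟩)) = φ' (u m)
  rw [sheafHomOf_app_ofMem, globalValue_ofMem]

include hφinj hspan in
/-- `f ↦ homOfSheafHom f ↦ f`. [this work] -/
theorem sheafHomOf_homOfSheafHom (hφ'inj : Function.Injective φ') (ρ : T →+* Γ(X, ⊤))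
    (hρ : ∀ a : T, X.germToFunctionField ⊤ (ρ a) = algebraMap T X.functionField a)
    (hH0' : ∀ v : V', (∀ x : X, v ∈ stalkSpan (X := X) V' (Set.range φ') x) ↔ v ∈ Set.range φ')
    (f : generatedSheaf (X := X) V (Set.range φ) ⟶ generatedSheaf V' (Set.range φ')) :
    sheafHomOf φ φ' hφinj hspan (homOfSheafHom φ φ' hφ'inj ρ hρ hH0' f) = f := by
  refine hom_ext_of_app_ofMem V (Set.range φ) _ _ fun U _ _ v hv => ?_
  obtain ⟨m, rfl⟩ := hv
  rw [sheafHomOf_app_ofMem]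
  have hres : ofMem V (Set.range φ) U (φ m) ⟨m, rfl⟩ =
      (generatedSheaf V (Set.range φ)).presheaf.map (homOfLE (le_top : U ≤ ⊤)).op (secOf φ m) :=
    section_ext V (Set.range φ) (funext fun _ => rfl)
  rw [hres, Scheme.Modules.Hom.app_map_apply]
  refine section_ext V' (Set.range φ') (funext fun y => ?_)
  rw [fn_ofMem, fn_map_top, map_homOfSheafHom]

include hφinj hspan in
/-- **`Hom_T(M, M′) ≃ Hom(M~, M′~)`** (additive), GIVEN (ii) for `M′`. [this work] -/
def sheafHomEquiv (hφ'inj : Function.Injective φ') (ρ : T →+* Γ(X, ⊤))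
    (hρ : ∀ a : T, X.germToFunctionField ⊤ (ρ a) = algebraMap T X.functionField a)
    (hH0' : ∀ v : V', (∀ x : X, v ∈ stalkSpan (X := X) V' (Set.range φ') x) ↔ v ∈ Set.range φ') :
    (M →ₗ[T] M') ≃+ (generatedSheaf (X := X) V (Set.range φ) ⟶ generatedSheaf V' (Set.range φ')) where
  toFun := sheafHomOf φ φ' hφinj hspan
  invFun := homOfSheafHom φ φ' hφ'inj ρ hρ hH0'
  left_inv := homOfSheafHom_sheafHomOf φ φ' hφinj hspan hφ'inj ρ hρ hH0'
  right_inv := sheafHomOf_homOfSheafHom φ φ' hφinj hspan hφ'inj ρ hρ hH0'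
  map_add' := sheafHomOf_add φ φ' hφinj hspan

end Sheaf

end Summit.ResolutionOfSingularities.ResolutionOfSingularities.Theorems.NoZeno.SandwichCluster.FullSheaf

end
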